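import Summits.QuantumFields.BalabanUV.Beta.GAN24.WindowSlotRows
import Summits.QuantumFields.BalabanUV.Beta.GAN24.LegLetterSlotDivergenceRows

/-!
# `BalabanUV.Beta.GAN24.LegLetterWindowRows` — binder row G-an2-4 ∕ (CONV-C), W-slot, the (α-0) parity re-cut, located crux (Q-L-k₀): **THE WINDOW's FIVE SLOT ROWS OF A
# LEG LETTER `rdiv ∘ y` FROM THE TWO SLAVED SLOT-DIVERGENCE ROWS OF `y`** — (H3)∕(H3d) of MY g68 FILE 5 `WrecAtEvenHalfRowsOfWindows` (the slaved longitudinal amplitude, in the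
# window's five-row currency `GoodL ∕ GoodLD`) FROM leaf-03 g66's `h₁ ∕ h₂` rows = leaf-01 g72 (b1) PART 4 `HalfMemberSlavedDivergenceLetters.slotLetters_halfMember_succ_of_rows` ∕
# `HalfMemberSlavedDivergenceDrift{,Snd}`'s CONCLUSIONS (G-an2-4 formalisation swarm, leaf prover `b2b-balaban-gan24-formalise-leaf-03`, gen 69; FILE 2 of the journal INTENT
# [LEAF03-G69-ONLINE] ∕ A-1 [LEAF03-G69-A1])

NOT IN PRINT; OUR BOOKKEEPING ([folklore] composition BY NAME; 0 `def`, 0 cited facts, 0 `def … : Prop`, 0 sorry).  HONEST FRAMING (cell contract, verbatim):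
«discharging `BetaPertH` makes Bałaban's UV stability UNCONDITIONAL — a real constructive-QFT result; it is NOT the continuum limit and NOT the Clay problem.»
HONEST DEPENDENCY (verbatim): «continuum YM on T⁴ ⇐ BetaPertH ∧ nine spine estimates (0/9 proved); BetaPertH ⇐ (D1) ∧ (D4) ∧ CAP+tail; G-an2-4 gates asym, D1
and NE2/3/4.»

WHAT (generic `d`, ANY table `y`, rate `0 < δ`): **`exists_windowRows_legLetter_of_divRows`** — there is `Γ = Γ(d, δ) ≥ 0` such that for every table `y` whose leg letter
`rdiv ∘ y` is `LocStencil₂` at SOME positive rate (the ruled class's third conjunct — for the comb members: 8b `LegRowsOnRuledClass.halfMember_legLetter_mem ….2.2`, for their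
drifts `halfMember_legDrift_mem ….2.2`) and whose two slot-divergence tables obey `h₁ : LocStencil₂ (fun _ p κ′ u′ ↦ divV (κ₁u₁ ↦ y κ₁ u₁ κ′ u′) p) C₁ δ` and
`h₂ : LocStencil₂ (fun κ u _ p ↦ divV (κ₁u₁ ↦ y κ u κ₁ u₁) p) C₂ δ`, the five rows `hq₂ hq₁ hq₁₂ hD₂ hD₁` of the window theorem hold for `W := rdiv ∘ y` with constant
`Γ·(C₁ + C₂)` at rate `δ∕3` — MY g68 FILE 7 `slotDiv_fst∕snd_legLetter_le` (the window's divergence rows of the leg letter, `(d+1)(e^δ+1)·Cᵢ`, same rate) ⨾ FILE 1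
`WindowSlotRows.exists_windowRows_of_divRows` (the charges by leaf-01's moment device, `C`-free).  Per level: uniform rows in ⟹ uniform rows out ((H3), `σ`); geometric rows in ⟹
geometric rows out ((H3d), `σd·ν^n`, the drift table `rdiv ∘ (y_{n+1} − y_n) = rdiv ∘ y_{n+1} − rdiv ∘ y_n` by `LegDriftRowsOfLegChain.rdiv_comp_sub` at the call).
Asserts NOTHING about Bałaban's tables; PART 4's own inputs (F4 source row, the S-slot letter rows of the slaved summand, D1's table laws) stay where they are; NOTHING of
(Q-L) ∕ (H1♮) ∕ (H1Δw) ∕ (C)sym discharged; NEVER «G-an2-4 closed» as (CONV-C); NOT D1, NOT `BetaPertH`, NOT continuum, NOT Clay; not in print.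
Unit `b2b-balaban-gan24-formalise-leaf-03` (gen 69), 2026-08-23.
-/

noncomputable section

open Finset
open scoped BigOperators
open Literature.MathematicalPhysics.QuantumFieldTheory.Balaban1983to89
open Literature.MathematicalPhysics.QuantumFieldTheory.Balaban1983to89.Beta
open B6BondElimination (unitVec)
open B12Sec2to5 (l1 l1_nonneg)
open ExpKernelCalculus (MKer)
open OneStepResolventKernel (Fib)
open BalabanCompositeJets (LocStencil₂ LocStencil₂.nonneg)
open KernelWard (divV)
open Summit.QuantumFields.BalabanUV.Beta.GAN24.BiStencilZeroMode (Tab)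
open Summit.QuantumFields.BalabanUV.Beta.GAN24.Lin4LegTower (rdiv)
open Summit.QuantumFields.BalabanUV.Beta.GAN24.WindowSlotRows (exists_windowRows_of_divRows row_weaken₂)
open Summit.QuantumFields.BalabanUV.Beta.GAN24.LegLetterSlotDivergenceRows (slotDiv_fst_legLetter_le slotDiv_snd_legLetter_le)

namespace Summit.QuantumFields.BalabanUV.Beta.GAN24.LegLetterWindowRows

variable {d : ℕ}

/-- NOT IN PRINT; OUR BOOKKEEPING.  **THE WINDOW's FIVE SLOT ROWS OF THE LEG LETTER `rdiv ∘ y` FROM THE TWO SLAVED SLOT-DIVERGENCE ROWS OF `y`** (`0 < δ`; `Γ = Γ(d, δ)`):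
`(∃ C₀ δ₀ > 0, LocStencil₂ (rdiv ∘ y) C₀ δ₀) → h₁(C₁, δ) → h₂(C₂, δ) → ⟨hq₂ ∧ hq₁ ∧ hq₁₂ ∧ hD₂ ∧ hD₁⟩ (rdiv ∘ y) (Γ·(C₁ + C₂), δ∕3)` — (H3)∕(H3d) of
`WrecAtEvenHalfRowsOfWindows` in leaf-03 g66's `h₁∕h₂` currency (FILE 7 ⨾ FILE 1 §3). -/
theorem exists_windowRows_legLetter_of_divRows (d : ℕ) {δ : ℝ} (hδ : 0 < δ) :
    ∃ Γ : ℝ, 0 ≤ Γ ∧ ∀ (y : Tab d) (C₁ C₂ : ℝ),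
      (∃ C₀ δ₀ : ℝ, 0 < δ₀ ∧ LocStencil₂ (fun κ u κ' u' => rdiv (y κ u κ' u')) C₀ δ₀) →
      LocStencil₂ (fun (_ : Fin (d + 1)) (p : Fin (d + 1) → ℤ) (κ' : Fin (d + 1)) (u' : Fin (d + 1) → ℤ) => divV (fun κ₁ u₁ => y κ₁ u₁ κ' u') p) C₁ δ →
      LocStencil₂ (fun (κ : Fin (d + 1)) (u : Fin (d + 1) → ℤ) (_ : Fin (d + 1)) (p : Fin (d + 1) → ℤ) => divV (fun κ₁ u₁ => y κ u κ₁ u₁) p) C₂ δ →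
      (∀ (κ₁ : Fin (d + 1)) (v : Fin (d + 1) → ℤ) (κ₂ : Fin (d + 1)) (x p : Fin (d + 1) → ℤ) (f b : Fib d),
          |∑' v', (fun κ u κ' u' => rdiv (y κ u κ' u')) κ₁ v κ₂ v' x p f b| ≤ Γ * (C₁ + C₂) * Real.exp (-(δ / 3) * (l1 (x - v) + l1 (p - v)))) ∧
      (∀ (κ₁ κ₂ : Fin (d + 1)) (v' x p : Fin (d + 1) → ℤ) (f b : Fib d),
          |∑' v, (fun κ u κ' u' => rdiv (y κ u κ' u')) κ₁ v κ₂ v' x p f b| ≤ Γ * (C₁ + C₂) * Real.exp (-(δ / 3) * (l1 (x - v') + l1 (p - v')))) ∧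
      (∀ (κ₁ κ₂ : Fin (d + 1)) (x p : Fin (d + 1) → ℤ) (f b : Fib d),
          |∑' v, ∑' v', (fun κ u κ' u' => rdiv (y κ u κ' u')) κ₁ v κ₂ v' x p f b| ≤ Γ * (C₁ + C₂) * Real.exp (-(δ / 3) * l1 (p - x))) ∧
      (∀ (κ : Fin (d + 1)) (v w x p : Fin (d + 1) → ℤ) (f b : Fib d),
          |∑ μ, ((fun κ u κ' u' => rdiv (y κ u κ' u')) κ v μ (w - unitVec μ) x p f b - (fun κ u κ' u' => rdiv (y κ u κ' u')) κ v μ w x p f b)|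
            ≤ Γ * (C₁ + C₂) * Real.exp (-(δ / 3) * l1 (w - v)) * Real.exp (-(δ / 3) * (l1 (x - v) + l1 (p - v)))) ∧
      (∀ (κ' : Fin (d + 1)) (w v' x p : Fin (d + 1) → ℤ) (f b : Fib d),
          |∑ κ, ((fun κ u κ' u' => rdiv (y κ u κ' u')) κ (w - unitVec κ) κ' v' x p f b - (fun κ u κ' u' => rdiv (y κ u κ' u')) κ w κ' v' x p f b)|
            ≤ Γ * (C₁ + C₂) * Real.exp (-(δ / 3) * l1 (v' - w)) * Real.exp (-(δ / 3) * (l1 (x - w) + l1 (p - w)))) := by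
  obtain ⟨Γ₃, hΓ₃, hrows⟩ := exists_windowRows_of_divRows d hδ
  set E : ℝ := ((d + 1 : ℕ) : ℝ) * (Real.exp δ + 1) with hE
  have hE0 : 0 ≤ E := by rw [hE]; positivity
  refine ⟨Γ₃ * E, mul_nonneg (by linarith) hE0, ?_⟩
  intro y C₁ C₂ hy h₁ h₂
  have hC₁ : 0 ≤ C₁ := h₁.nonneg
  have hC₂ : 0 ≤ C₂ := h₂.nonneg
  -- the window's two divergence rows of the leg letter (FILE 7), common constant `E·(C₁+C₂)`
  have hle₁ : ((d + 1 : ℕ) : ℝ) * (Real.exp δ + 1) * C₁ ≤ E * (C₁ + C₂) := by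
    rw [hE]; exact mul_le_mul_of_nonneg_left (by linarith) hE0
  have hle₂ : ((d + 1 : ℕ) : ℝ) * (Real.exp δ + 1) * C₂ ≤ E * (C₁ + C₂) := by
    rw [hE]; exact mul_le_mul_of_nonneg_left (by linarith) hE0
  have hD₂ : ∀ (κ : Fin (d + 1)) (v w x p : Fin (d + 1) → ℤ) (f b : Fib d),
      |∑ μ, ((fun κ u κ' u' => rdiv (y κ u κ' u')) κ v μ (w - unitVec μ) x p f b - (fun κ u κ' u' => rdiv (y κ u κ' u')) κ v μ w x p f b)|
        ≤ E * (C₁ + C₂) * Real.exp (-δ * l1 (w - v)) * Real.exp (-δ * (l1 (x - v) + l1 (p - v))) := fun κ v w x p f b =>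
    row_weaken₂ hle₂ le_rfl (l1_nonneg _) (add_nonneg (l1_nonneg _) (l1_nonneg _)) (slotDiv_snd_legLetter_le hδ.le h₂ κ v w x p f b)
  have hD₁ : ∀ (κ' : Fin (d + 1)) (w v' x p : Fin (d + 1) → ℤ) (f b : Fib d),
      |∑ κ, ((fun κ u κ' u' => rdiv (y κ u κ' u')) κ (w - unitVec κ) κ' v' x p f b - (fun κ u κ' u' => rdiv (y κ u κ' u')) κ w κ' v' x p f b)|
        ≤ E * (C₁ + C₂) * Real.exp (-δ * l1 (v' - w)) * Real.exp (-δ * (l1 (x - w) + l1 (p - w))) := fun κ' w v' x p f b =>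
    row_weaken₂ hle₁ le_rfl (l1_nonneg _) (add_nonneg (l1_nonneg _) (l1_nonneg _)) (slotDiv_fst_legLetter_le hδ.le h₁ κ' w v' x p f b)
  have h := hrows (fun κ u κ' u' => rdiv (y κ u κ' u')) (E * (C₁ + C₂)) hy hD₂ hD₁
  have key : Γ₃ * (E * (C₁ + C₂)) = Γ₃ * E * (C₁ + C₂) := by ring
  simp only [key] at h
  exact h

end Summit.QuantumFields.BalabanUV.Beta.GAN24.LegLetterWindowRows

end
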